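import Summits.BirchSwinnertonDyer.Rank1Residual.GaloisImage.KolyvaginTransferCocycle
import HarnessLib

/-!
# THEOREM C of row T-DER, generic form: the finite–singular relation from the transfer identity
# and the Kolyvagin congruence (Nekovář / Perrin-Riou) — file G2 (cell `b2b-bsdres`, team n1011,
# seat p11 GEN 9, OWNERS row T-DER = skel/T-DER.md STATUS v8 (v8-2), referee-1 GEN 35 ACK-1)

HONEST FRAMING (cell `b2b-bsdres`, run/shared/lean/b2b/bsd-rank1-residual/, verbatim in every
file): the goal of the cell is to DELETE the COMBINATION-SHAPED residual classes of the
Birch–Swinnerton-Dyer formula for ALL analytic-rank `≤ 1` elliptic curves over `ℚ` — "full BSD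
formula for every rank `≤ 1` curve in class `C`" assembled STRICTLY from published theorems — so
that the rank-`≤ 1` remainder becomes exactly the CONSTRUCTION-SHAPED classes, which are TYPED
(missing-input `Prop`s), NOT attempted. This is not "finishing BSD". Team n1011: research route on
the CONSTRUCTION-SHAPED class X4 / §I N11 (route-1 PORT, (P-DER)); TOOL theorems of continuous
group cohomology (no definition, no named fact, no `sorry`); curve-free, `p`-free.

## What ([Rubin00] Thm. 4.5.4 = [PerrinRiou98] §3.1.2 + Prop. 3.1.6 + Prop. 2.2.5 (ii), generic)

Setting (the letters of skel/T-DER.md STATUS v8 (v8-2)): a topological group `G` (`Γ_K`), two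
topological `R`-representations `Y` (the lattice `T`) and `X` (`W_M = T/M`) with an equivariant
continuous linear map `red : Y ⟶ X`, normal subgroups `N ≤ N'` (`Gal(K̄/F(rq)) ≤ Gal(K̄/F(r))`),
an element `σ` acting trivially on `Y` and `X` with `σ^{N_q} ∈ N` (the tame generator, chosen in
the inertia group at `𝔔 ∣ q`), an element `Fr` (an arithmetic Frobenius at `𝔔`) and an element
`φ ∈ N` (a Frobenius of `F(rq)_𝔔`: `φ ≡ Fr^f` modulo inertia), a polynomial `P ∈ R[X]` (Rubin's
`P(Fr_q⁻¹ | T*; X)`) with `P(Fr⁻¹) = N_q • Z` as operators on `Y` (`hZ`; for `T_p E`: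
`Z = q⁻¹Fr⁻²(a_q Fr − q − 1)`, file K4), `Y`-valued cocycles `x` on `N` and `x_r` on `N'`
(representatives of `D_r c_{rq}` and `D_r c_r`), the **`T`-level transfer identity**
`htrans : Σ_{i<N_q} σ^i x(σ^{-i}uσ^i) = Σ_k p_k • Fr^{-k} x_r(Fr^k u Fr^{-k}) + (u b̃ − b̃)` on `N`
(file G1 `exists_forall_sum_rho_pow_apply_eq_of_coresLe_eq_aeval` from `IsEulerSystem.cores_cons`),
the vanishing of `x`, `x_r` on the inertia elements met (`hkill`, `hkillr`, `hyN`), injectivity of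
`φ − 1` on `Y` (`hinj`; Weil), and **the Kolyvagin congruence**
`hcong : ∃ t, x(φ) − Z x_r(φ) = (φ − 1) t` ([PerrinRiou98] Prop. 2.2.5 (ii) / Rubin, LNM 1716
Prop. 8.6 — a DISPLAYED binder here, supplied for Euler systems from `IsEulerSystem.cores_p` by the
files C0a–C0d; referee-1 GEN 35 proviso (i)).  Let `Φ_r` be a global cocycle extending `red ∘ x_r`
on `N'` and `Φ` a global cocycle extending the derivative cocycle `D_σ(red ∘ x) = Σ i • σ^i·(red∘x)`
on `N` (file C1 `exists_extend_of_forall_conjMap_eq`).  THEN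

  **`Φ(σ) = Q(Fr⁻¹) Φ_r(Fr)`**  for every `Q ∈ R[X]` with `(X − 1)·Q = P − P(1)`

(`apply_eq_aeval_apply_of_congruence`).  Steps: (EVAL) `htrans` at `u = φ` reads
`N_q x(φ) = N_q Z x_r(φ) + (φ−1)b̃` ([PerrinRiou98] Prop. 3.1.6); (FIN) with `hcong`,
`(φ−1)(b̃ − N_q t) = 0`, so `b̃ = N_q t` and `red b̃ = 0` (`N_q X = 0`); reducing `htrans` by `red`
and (C-a) (C1 `smul_apply_subgroupConj_sub_apply`) gives the norm witness `a = Σ_k p_k • Φ_r(Fr^{-k})`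
of `D_σ`'s input, so C2 `apply_eq_neg_of_norm_eq_coboundary` yields `Φ(σ) = −a`; finally
`−Σ_k p_k Φ_r(Fr^{-k}) = Fr⁻¹Q(Fr⁻¹)Φ_r(Fr) = Q(Fr⁻¹)Φ_r(Fr)` (cocycle on powers; `P(Fr⁻¹)` and
`P(1)` kill `X`).  With `Q` the tree's `comparisonQ` this is the cocycle form of
`IsFiniteSingularComparisonWith` (file C4).  0 defs, 0 facts.

References: B. Perrin-Riou, Ann. Inst. Fourier 48 (1998), §3.1.2, Prop. 3.1.6, Prop. 2.2.5 (ii);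
K. Rubin, *Euler Systems* (2000), Thm. 4.5.4, §4.7–§4.8; K. Rubin, in LNM 1716 (1999), Prop. 8.6,
Prop. 8.10 (ii); J. Nekovář, Invent. math. 107 (1992), §§5–6.
-/

noncomputable section

open CategoryTheory Function Finset Polynomial
open Literature.NumberTheory.GaloisRepresentations
open Literature.NumberTheory.EllipticCurves (subgroupInclusion subgroupInclusion_apply_coe
  subgroupConj subgroupConj_apply_coe)

universe u v

namespace Summit.BirchSwinnertonDyer.Rank1Residual.GaloisImage

namespace Derivative

section FiniteSingular

variable {R : Type v} [CommRing R] [TopologicalSpace R]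
variable {G : Type u} [Group G] [TopologicalSpace G] [IsTopologicalGroup G]
variable (X : TopRep.{u} R G)

/-! ### §1 Values of a global cocycle at powers and at inverses -/

omit [IsTopologicalGroup G] in
/-- **A global cocycle on powers**: `Φ(g^k) = Σ_{j<k} g^j Φ(g)`. [folklore] -/
theorem apply_pow_eq_sum_rho_pow_apply (Φ : contOneCocycles X) (g : G) (k : ℕ) :
    Φ.1 (g ^ k) = ∑ j ∈ range k, X.ρ (g ^ j) (Φ.1 g) := by
  induction k with
  | zero => rw [pow_zero, sum_range_zero]; exact contOneCocycles.apply_one _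
  | succ k ih => rw [pow_succ, Φ.2, ih, sum_range_succ]

omit [IsTopologicalGroup G] in
/-- **A global cocycle at the powers of an inverse**: `Φ(g⁻¹^k) = −Σ_{j<k} (g⁻¹)^{j+1} Φ(g)`
(`Φ(g⁻¹) = −g⁻¹Φ(g)`). [folklore] -/
theorem apply_inv_pow_eq_neg_sum (Φ : contOneCocycles X) (g : G) (k : ℕ) :
    Φ.1 (g⁻¹ ^ k) = -∑ j ∈ range k, X.ρ (g⁻¹ ^ (j + 1)) (Φ.1 g) := by
  rw [apply_pow_eq_sum_rho_pow_apply, contOneCocycles.apply_inv, ← sum_neg_distrib]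
  refine sum_congr rfl fun j _ => ?_
  rw [map_neg, ← ρ_mul_apply, ← pow_succ]

/-! ### §2 The polynomial bookkeeping `−Σ_k p_k Φ(Fr^{-k}) = Fr⁻¹ Q(Fr⁻¹) Φ(Fr)` -/

omit [TopologicalSpace R] in
/-- **`X·Q = Σ_k p_k Σ_{j<k} X^{j+1}`** for `(X − 1)·Q = P − P(1)`: both sides times the monic
`X − 1` give `X·(P − P(1))`. [folklore] -/
theorem X_mul_eq_sum_of_X_sub_one_mul_eq (P Q : R[X])
    (hQ : (Polynomial.X - C 1) * Q = P - C (P.eval 1)) :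
    Polynomial.X * Q = ∑ k ∈ range (P.natDegree + 1),
      C (P.coeff k) * ∑ j ∈ range k, Polynomial.X ^ (j + 1) := by
  have hmonic : (Polynomial.X - C (1 : R)).Monic := monic_X_sub_C 1
  -- `P(1) = Σ_k p_k`
  have heval : P.eval 1 = ∑ k ∈ range (P.natDegree + 1), P.coeff k := by
    rw [eval_eq_sum_range]
    exact sum_congr rfl fun k _ => by rw [one_pow, mul_one]
  -- `(X − 1) Σ_{j<k} X^{j+1} = X (X^k − 1)`
  have hgeom : ∀ k : ℕ, (Polynomial.X - C (1 : R)) * ∑ j ∈ range k, Polynomial.X ^ (j + 1) =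
      Polynomial.X * (Polynomial.X ^ k - 1) := fun k => by
    have h : ∑ j ∈ range k, (Polynomial.X : R[X]) ^ (j + 1) =
        Polynomial.X * ∑ j ∈ range k, Polynomial.X ^ j := by
      rw [mul_sum]; exact sum_congr rfl fun j _ => by rw [pow_succ']
    rw [h, map_one, mul_left_comm, mul_geom_sum]
  have hrhs : (Polynomial.X - C (1 : R)) * ∑ k ∈ range (P.natDegree + 1),
      C (P.coeff k) * ∑ j ∈ range k, Polynomial.X ^ (j + 1) =
        Polynomial.X * (P - C (P.eval 1)) := by
    rw [mul_sum]
    have hk : ∀ k ∈ range (P.natDegree + 1), (Polynomial.X - C (1 : R)) *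
        (C (P.coeff k) * ∑ j ∈ range k, Polynomial.X ^ (j + 1)) =
          Polynomial.X * (C (P.coeff k) * Polynomial.X ^ k - C (P.coeff k)) := fun k _ => by
      rw [mul_left_comm, hgeom k]; ring
    rw [sum_congr rfl hk, ← mul_sum, sum_sub_distrib, ← P.as_sum_range_C_mul_X_pow, heval, map_sum]
  have hlhs : (Polynomial.X - C (1 : R)) * (Polynomial.X * Q) = Polynomial.X * (P - C (P.eval 1)) := by
    rw [mul_left_comm, hQ]
  have hzero : (Polynomial.X - C (1 : R)) * (Polynomial.X * Q - ∑ k ∈ range (P.natDegree + 1),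
      C (P.coeff k) * ∑ j ∈ range k, Polynomial.X ^ (j + 1)) = 0 := by
    rw [mul_sub, hlhs, hrhs, sub_self]
  exact sub_eq_zero.mp (hmonic.mul_right_eq_zero_iff.mp hzero)

variable {Y₀ : Type*} [AddCommGroup Y₀] [Module R Y₀]

omit [TopologicalSpace R] in
/-- **`−Σ_k p_k Φ_k = F·Q(F) v`** whenever `Φ_k = −Σ_{j<k} F^{j+1} v` (the values of a cocycle at
`Fr^{-k}`, `F = Fr⁻¹`, `v = Φ(Fr)`) and `(X − 1)Q = P − P(1)`. [folklore] -/
theorem neg_sum_smul_eq_apply_aeval (F : Module.End R Y₀) (P Q : R[X])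
    (hQ : (Polynomial.X - C 1) * Q = P - C (P.eval 1)) (v : Y₀) (w : ℕ → Y₀)
    (hw : ∀ k, w k = -∑ j ∈ range k, (F ^ (j + 1)) v) :
    -∑ k ∈ range (P.natDegree + 1), P.coeff k • w k = F (aeval F Q v) := by
  have h := congrArg (fun S : R[X] => aeval F S v) (X_mul_eq_sum_of_X_sub_one_mul_eq P Q hQ)
  simp only [map_mul, aeval_X, Module.End.mul_apply, map_sum, aeval_C, map_pow,
    LinearMap.sum_apply, Module.algebraMap_end_apply] at h
  rw [h, ← sum_neg_distrib]
  refine sum_congr rfl fun k _ => ?_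
  rw [hw k, smul_neg, neg_neg, smul_sum]

omit [TopologicalSpace R] in
/-- **`F·Q(F)v = Q(F)v` when `P(F)v = 0` and `P(1)v = 0`**: `(F − 1)Q(F) = P(F) − P(1)`.
[folklore] -/
theorem apply_aeval_eq_aeval_of_kill (F : Module.End R Y₀) (P Q : R[X])
    (hQ : (Polynomial.X - C 1) * Q = P - C (P.eval 1)) (v : Y₀) (hPv : aeval F P v = 0)
    (hP1 : P.eval 1 • v = 0) : F (aeval F Q v) = aeval F Q v := by
  have h := congrArg (fun S : R[X] => aeval F S v) hQ
  simp only [map_mul, map_sub, aeval_X, aeval_C, Module.End.mul_apply, LinearMap.sub_apply,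
    Module.algebraMap_end_apply, one_smul, hPv, hP1, sub_zero] at h
  exact sub_eq_zero.mp h

/-! ### §3 THEOREM C, generic form -/

variable (Y : TopRep.{u} R G) (red : Y ⟶ X) (N N' : Subgroup G) [N.Normal] [N'.Normal]

/-- **(EVAL) + (FIN): the rigidified Euler defect vanishes modulo `M`** ([PerrinRiou98] Prop. 3.1.6
with Prop. 2.2.5 (ii)).  In the setting of the module docstring: the `T`-level transfer identity
`htrans` evaluated at the Frobenius `φ ∈ N` gives `N_q x(φ) = N_q Z x_r(φ) + (φ − 1) b̃`
(`σ` acts trivially on `Y`, `x` kills the inertia elements `φ⁻¹σ^{-i}φσ^i`, `x_r` kills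
`φ⁻¹Fr^kφFr^{-k}`, and `P(Fr⁻¹) = N_q Z`); the congruence `x(φ) − Z x_r(φ) ∈ (φ − 1)Y` and the
injectivity of `φ − 1` on `Y` then force `b̃ = N_q • t`, so `red b̃ = 0` as `N_q` kills `X`.
[cite: PerrinRiou1998AIF, Prop. 3.1.6 and Prop. 2.2.5 (ii)] -/
theorem red_witness_eq_zero_of_congruence (hNN' : N ≤ N') (σ Fr φ : G) (hφ : φ ∈ N)
    (hσY : ∀ t : Y, Y.ρ σ t = t) {Nq : ℕ} (hNqX : ∀ w : X, (Nq : ℤ) • w = 0)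
    (P : R[X]) (Z : Y →ₗ[R] Y)
    (hZ : ∀ t : Y, ∑ k ∈ range (P.natDegree + 1), P.coeff k • Y.ρ (Fr⁻¹ ^ k) t = Nq • Z t)
    (hinj : Function.Injective fun t : Y => Y.ρ φ t - t)
    (x : contOneCocycles (subgroupRep Y N)) (xr : contOneCocycles (subgroupRep Y N')) (bt : Y)
    (hkill : ∀ i : ℕ, x.1 (⟨φ, hφ⟩⁻¹ * subgroupConj N (σ ^ i) ⟨φ, hφ⟩) = 0)
    (hkillr : ∀ k : ℕ,
      xr.1 (⟨φ, hNN' hφ⟩⁻¹ * subgroupConj N' (Fr⁻¹ ^ k) ⟨φ, hNN' hφ⟩) = 0)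
    (htrans : ∀ u : N, ∑ i ∈ range Nq, Y.ρ (σ ^ i) (x.1 (subgroupConj N (σ ^ i) u)) =
      ∑ k ∈ range (P.natDegree + 1),
          P.coeff k • Y.ρ (Fr⁻¹ ^ k) (xr.1 (subgroupConj N' (Fr⁻¹ ^ k) (subgroupInclusion hNN' u))) +
        (Y.ρ (u : G) bt - bt))
    (hcong : ∃ t : Y, x.1 ⟨φ, hφ⟩ - Z (xr.1 ⟨φ, hNN' hφ⟩) = Y.ρ φ t - t) :
    red.hom bt = 0 := by
  obtain ⟨t, ht⟩ := hcong
  -- (EVAL) left side: `Σ σ^i x(σ^{-i}φσ^i) = N_q • x(φ)`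
  have hL := sum_rho_pow_apply_subgroupConj_eq_nsmul Y N σ hσY Nq x ⟨φ, hφ⟩ hkill
  -- right side: `x_r(Fr^k φ Fr^{-k}) = x_r(φ)`
  have hincl : subgroupInclusion hNN' ⟨φ, hφ⟩ = ⟨φ, hNN' hφ⟩ := rfl
  have hR : ∀ k : ℕ, xr.1 (subgroupConj N' (Fr⁻¹ ^ k) ⟨φ, hNN' hφ⟩) = xr.1 ⟨φ, hNN' hφ⟩ := by
    intro k
    have hmul : subgroupConj N' (Fr⁻¹ ^ k) ⟨φ, hNN' hφ⟩ =
        ⟨φ, hNN' hφ⟩ * (⟨φ, hNN' hφ⟩⁻¹ * subgroupConj N' (Fr⁻¹ ^ k) ⟨φ, hNN' hφ⟩) := by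
      rw [mul_inv_cancel_left]
    rw [hmul, subgroup_cocycle_mul, hkillr k, map_zero, add_zero]
  have hE := htrans ⟨φ, hφ⟩
  rw [hL, hincl] at hE
  simp only [hR] at hE
  rw [hZ] at hE
  -- (FIN) compare with `N_q •` the congruence
  have hE' : (Nq • (x.1 ⟨φ, hφ⟩ - Z (xr.1 ⟨φ, hNN' hφ⟩)) : Y) = Y.ρ φ bt - bt := by
    rw [smul_sub, hE]; abel
  rw [ht, smul_sub, ← map_nsmul] at hE'
  have hbt : bt = Nq • t := hinj (by simp only [hE'])
  rw [hbt, map_nsmul, ← natCast_zsmul, hNqX]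

/-- **THEOREM C (generic form) — the finite–singular relation from the transfer identity and the
Kolyvagin congruence** ([Rubin00] Thm. 4.5.4; [PerrinRiou98] §3.1.2, Prop. 3.1.6, Prop. 2.2.5 (ii);
Rubin, LNM 1716, Prop. 8.10 (ii)).  In the setting of the module docstring — `red : Y ⟶ X`
equivariant, `N ≤ N'` normal, `σ` acting trivially on `Y` and `X` with `σ^{N_q} ∈ N`, `N_q` and
`P(1)` and `P(Fr⁻¹)` killing `X`, `X^N = 0`, `Y`-valued cocycles `x` on `N` (killing the inertia
elements `φ⁻¹σ^{-i}φσ^i` and `σ^{N_q}`) and `x_r` on `N'` (killing `φ⁻¹Fr^kφFr^{-k}`), the `T`-LEVEL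
TRANSFER IDENTITY `htrans` with witness `b̃` (file G1 from `IsEulerSystem.cores_cons`), the operator
identity `P(Fr⁻¹) = N_q • Z` on `Y`, `φ − 1` injective on `Y`, and the KOLYVAGIN CONGRUENCE
`hcong : ∃ t, x(φ) − Z x_r(φ) = (φ−1)t` (a DISPLAYED binder: [PerrinRiou98] Prop. 2.2.5 (ii) /
Rubin LNM 1716 Prop. 8.6, supplied from `IsEulerSystem.cores_p` by files C0a–C0d) — for every global
cocycle `Φ_r` extending `red ∘ x_r` on `N'` and every global cocycle `Φ` extending the derivative
cocycle `u ↦ Σ_{i<N_q} i • σ^i red(x(σ^{-i}uσ^i))` on `N`: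
**`Φ(σ) = Q(Fr⁻¹)·Φ_r(Fr)`** for any `Q` with `(X − 1)Q = P − P(1)` (Rubin's `Q_q`).
For an Euler system: `Φ = κ_{rq}`, `Φ_r = κ_r`, and this is `loc^s_q κ_{rq} = φ^{fs}_q(loc_q κ_r)`
on cocycles. [cite: Rubin2000, Thm. 4.5.4] [cite: PerrinRiou1998AIF, §3.1.2, Prop. 3.1.6, Prop. 2.2.5 (ii)] -/
theorem apply_eq_aeval_apply_of_congruence (hNN' : N ≤ N') (σ Fr φ : G) (hφ : φ ∈ N)
    (hσY : ∀ t : Y, Y.ρ σ t = t) (hσX : ∀ w : X, X.ρ σ w = w) {Nq : ℕ} (hσNq : σ ^ Nq ∈ N)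
    (hNqX : ∀ w : X, (Nq : ℤ) • w = 0)
    (h0 : ∀ v : X, (∀ n : N, X.ρ (n : G) v = v) → v = 0)
    (P Q : R[X]) (hQ : (Polynomial.X - C 1) * Q = P - C (P.eval 1))
    (hP1 : ∀ w : X, P.eval 1 • w = 0)
    (hPX : ∀ w : X, aeval ((X.ρ Fr⁻¹ : X →L[R] X) : Module.End R X) P w = 0)
    (Z : Y →ₗ[R] Y)
    (hZ : ∀ t : Y, ∑ k ∈ range (P.natDegree + 1), P.coeff k • Y.ρ (Fr⁻¹ ^ k) t = Nq • Z t)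
    (hinj : Function.Injective fun t : Y => Y.ρ φ t - t)
    (x : contOneCocycles (subgroupRep Y N)) (xr : contOneCocycles (subgroupRep Y N')) (bt : Y)
    (hkill : ∀ i : ℕ, x.1 (⟨φ, hφ⟩⁻¹ * subgroupConj N (σ ^ i) ⟨φ, hφ⟩) = 0)
    (hkillr : ∀ k : ℕ,
      xr.1 (⟨φ, hNN' hφ⟩⁻¹ * subgroupConj N' (Fr⁻¹ ^ k) ⟨φ, hNN' hφ⟩) = 0)
    (hyN : x.1 ⟨σ ^ Nq, hσNq⟩ = 0)
    (htrans : ∀ u : N, ∑ i ∈ range Nq, Y.ρ (σ ^ i) (x.1 (subgroupConj N (σ ^ i) u)) =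
      ∑ k ∈ range (P.natDegree + 1),
          P.coeff k • Y.ρ (Fr⁻¹ ^ k) (xr.1 (subgroupConj N' (Fr⁻¹ ^ k) (subgroupInclusion hNN' u))) +
        (Y.ρ (u : G) bt - bt))
    (hcong : ∃ t : Y, x.1 ⟨φ, hφ⟩ - Z (xr.1 ⟨φ, hNN' hφ⟩) = Y.ρ φ t - t)
    (Φr : contOneCocycles X) (hΦr : ∀ u : N', Φr.1 u = red.hom (xr.1 u))
    (Ψ : contOneCocycles (subgroupRep X N))
    (hΨ : ∀ u : N, Ψ.1 u =
      ∑ i ∈ range Nq, (i : ℤ) • X.ρ (σ ^ i) (red.hom (x.1 (subgroupConj N (σ ^ i) u))))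
    (Φ : contOneCocycles X) (hΦ : ∀ u : N, Φ.1 u = Ψ.1 u) :
    Φ.1 σ = aeval ((X.ρ Fr⁻¹ : X →L[R] X) : Module.End R X) Q (Φr.1 Fr) := by
  -- the reduced cocycle `y = red ∘ x` on `N`
  let y : contOneCocycles (subgroupRep X N) :=
    contOneCocycles.pullback (ContinuousMonoidHom.id N) ((TopRep.resFunctor N.subtype).map red) x
  have hy : ∀ u : N, y.1 u = red.hom (x.1 u) := fun u => rfl
  -- (EVAL) + (FIN): the witness `b̃` reduces to `0`
  have hb : red.hom bt = 0 :=
    red_witness_eq_zero_of_congruence X Y red N N' hNN' σ Fr φ hφ hσY hNqX P Z hZ hinj x xr bt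
      hkill hkillr htrans hcong
  -- the norm witness `a = Σ_k p_k • Φ_r(Fr^{-k})`
  set a : X := ∑ k ∈ range (P.natDegree + 1), P.coeff k • Φr.1 (Fr⁻¹ ^ k) with ha
  have hP1' : ∀ w : X, (∑ k ∈ range (P.natDegree + 1), P.coeff k) • w = 0 := fun w => by
    have h : P.eval 1 = ∑ k ∈ range (P.natDegree + 1), P.coeff k := by
      rw [eval_eq_sum_range]
      exact sum_congr rfl fun k _ => by rw [one_pow, mul_one]
    rw [← h]; exact hP1 w
  have hcor : ∀ u : N, ∑ i ∈ range Nq, X.ρ (σ ^ i) (y.1 (subgroupConj N (σ ^ i) u)) =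
      X.ρ (u : G) a - a := by
    intro u
    -- reduce `htrans` by `red`
    have h := congrArg red.hom (htrans u)
    simp only [map_sum, map_add, map_sub, map_smul, TopRep.hom_comm_apply] at h
    have hr : ∀ k : ℕ, X.ρ (Fr⁻¹ ^ k) (red.hom (xr.1 (subgroupConj N' (Fr⁻¹ ^ k)
        (subgroupInclusion hNN' u)))) = Φr.1 u + (X.ρ (u : G) (Φr.1 (Fr⁻¹ ^ k)) - Φr.1 (Fr⁻¹ ^ k)) := by
      intro k
      rw [← hΦr]
      have h1 := smul_apply_subgroupConj_sub_apply X N' Φr (Fr⁻¹ ^ k) (subgroupInclusion hNN' u)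
      rw [sub_eq_iff_eq_add'] at h1
      exact h1
    simp only [hr, smul_add, sum_add_distrib, hb, map_zero, sub_zero, add_zero] at h
    simp only [hy]
    rw [h, ← sum_smul, hP1', zero_add, ha, map_sum, ← sum_sub_distrib]
    exact sum_congr rfl fun k _ => by rw [map_smul, smul_sub]
  have hyN' : y.1 ⟨σ ^ Nq, hσNq⟩ = 0 := by rw [hy, hyN, map_zero]
  have hΨ' : ∀ u : N, Ψ.1 u = ∑ i ∈ range Nq, (i : ℤ) • X.ρ (σ ^ i) (y.1 (subgroupConj N (σ ^ i) u)) :=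
    fun u => by simp only [hy]; exact hΨ u
  -- C2: `Φ(σ) = −a`
  have hC2 := apply_eq_neg_of_norm_eq_coboundary X N σ hσX hσNq hNqX h0 y a hcor hyN' Ψ hΨ' Φ hΦ
  -- `−a = Fr⁻¹ Q(Fr⁻¹) Φ_r(Fr) = Q(Fr⁻¹) Φ_r(Fr)`
  set F : Module.End R X := ((X.ρ Fr⁻¹ : X →L[R] X) : Module.End R X) with hFdef
  have hF : ∀ (n : ℕ) (w : X), (F ^ n) w = X.ρ (Fr⁻¹ ^ n) w := fun n w => by
    rw [hFdef, ← ContinuousLinearMap.coe_pow, map_pow]; rfl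
  have hw : ∀ k : ℕ, Φr.1 (Fr⁻¹ ^ k) = -∑ j ∈ range k, (F ^ (j + 1)) (Φr.1 Fr) := fun k => by
    rw [apply_inv_pow_eq_neg_sum]
    exact congrArg _ (sum_congr rfl fun j _ => by rw [hF])
  rw [hC2, ha, neg_sum_smul_eq_apply_aeval F P Q hQ (Φr.1 Fr) _ hw]
  exact apply_aeval_eq_aeval_of_kill F P Q hQ _ (hPX _) (hP1 (Φr.1 Fr))

end FiniteSingular

end Derivative

end Summit.BirchSwinnertonDyer.Rank1Residual.GaloisImage

end
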